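import Summits.ABC.IUTFork.Cor312RamifiedShells
import HarnessLib

/-!
# [IUTchIII] Cor. 3.12 — the RAMIFIED SHEAR bed, II: the (Ind1),(Ind2)-group preserves the packet log-shell lattice; the swap family

Record-only file (D-0012; no `Prop` fact, nothing asserted about print) of the abc-iut cell, IUT REPAIR BRANCH (rung
LADDER-ABC:A2.RP), seat abc-iut-rp-m1 (gen 3). TAKES NO SIDE on [IUTchIII] Cor. 3.12. Sequel to `Cor312RamifiedShells` (part I:
the rank-2 shells `ramShells p` with Ism = ALL lattice automorphisms `GL_2(ℤ_(p))`, Dupuy–Hilado reading [cite: DupuyHilado2025, §4.9];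
tensor coordinates `coord x ε`).

CONTENTS. §1 `Integral` (all tensor coordinates `p`-integral = membership in the packet log-shell lattice `𝕀 = ⊗_i I`),
`coord_map_eq_sum` (a linear map acts on coordinates through its matrix in the tensor basis) and
**`actsIntegrally_of_mem_closure`: every element of `⟨(Ind1) ∪ (Ind2)⟩` maps `𝕀` INTO ITSELF on every packet, and so does its
inverse** (the (Ind2)-generators are Kronecker products of `GL_2(ℤ_(p))`-matrices, the (Ind1)-generators such products composed
with a permutation of the tensor factors). §2 the SWAP `1 ↔ π` (a lattice automorphism that is no `𝒪_K`-semi-linear isometry) and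
the swap family `swapFam ∈ (Ind2)` with `swapFam (e_ε) = e_{swap ∘ ε}`: it carries the `p`-adically smallest basis monomial
`e_{π…π}` to the largest `e_{1…1}` — the mover by which part III (`Cor312RamifiedSetting`) shows that the 𝒪_L-POLYDISCS are NOT
preserved and computes the hull of their orbit exactly. [claim: Mochizuki2012, status: disputed]
-/

noncomputable section

namespace Summit.ABC.IUTFork.Cor312Vol.RamifiedWitness

open Thm311 Cor312 Cor312.Checks Cor312.IdentifiedNonVacuity NaiveWitness Literature.IUT.LogThetaLattice

variable (p : ℕ)

/-! ## 1. Integral vectors; the (Ind1),(Ind2)-group preserves the packet log-shell lattice -/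

/-- A packet vector is INTEGRAL: all its tensor coordinates lie in `ℤ_(p)` — membership in the packet log-shell lattice
`𝕀 = ⊗_i I` (the `ℤ_(p)`-span of the tensor basis). [claim: Mochizuki2012, status: disputed] -/
def Integral (j : toyIndex.Label) (vQ : toyIndex.VQ) (x : (ramShells p).Packet j vQ) : Prop :=
  ∀ ε, IsPInt p (coord p j vQ x ε)

/-- The coordinates of `0` vanish. [folklore] -/
@[simp] theorem coord_zero (j : toyIndex.Label) (vQ : toyIndex.VQ) (ε : toyIndex.Caps j → Fin 2) :
    coord p j vQ 0 ε = 0 := by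
  unfold coord; rw [map_zero, Finsupp.zero_apply]

/-- Coordinates are additive. [folklore] -/
theorem coord_add (j : toyIndex.Label) (vQ : toyIndex.VQ) (x y : (ramShells p).Packet j vQ) (ε : toyIndex.Caps j → Fin 2) :
    coord p j vQ (x + y) ε = coord p j vQ x ε + coord p j vQ y ε := by
  unfold coord; rw [map_add, Finsupp.add_apply]

/-- Coordinates are homogeneous: `(c·x)_ε = c·x_ε`. [folklore] -/
theorem coord_smul (j : toyIndex.Label) (vQ : toyIndex.VQ) (c : ℚ) (x : (ramShells p).Packet j vQ) (ε : toyIndex.Caps j → Fin 2) :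
    coord p j vQ (c • x) ε = c * coord p j vQ x ε := by
  unfold coord; rw [map_smul, Finsupp.smul_apply, smul_eq_mul]

/-- A vector all of whose coordinates vanish is `0`. [folklore] -/
theorem eq_zero_of_coord_eq_zero (j : toyIndex.Label) (vQ : toyIndex.VQ) {x : (ramShells p).Packet j vQ}
    (h : ∀ ε, coord p j vQ x ε = 0) : x = 0 := by
  rw [← sum_coord_smul_tb p j vQ x]
  exact Finset.sum_eq_zero fun ε _ => by rw [h ε, zero_smul]

/-- `p^a · e_ε ≠ 0`. [folklore] -/
theorem ppow_smul_tb_ne_zero [Fact p.Prime] (j : toyIndex.Label) (vQ : toyIndex.VQ) (a : ℤ) (ε : toyIndex.Caps j → Fin 2) :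
    (p : ℚ) ^ a • tb p j vQ ε ≠ 0 :=
  smul_ne_zero (ppow_ne_zero p a) ((tb p j vQ).ne_zero ε)

/-- **A linear map acts on coordinates through its matrix in the tensor basis**: `(f x)_ε = Σ_{ε'} x_{ε'}·(f e_{ε'})_ε`. [folklore] -/
theorem coord_map_eq_sum (j : toyIndex.Label) (vQ : toyIndex.VQ) (f : (ramShells p).Packet j vQ →ₗ[ℚ] (ramShells p).Packet j vQ)
    (x : (ramShells p).Packet j vQ) (ε : toyIndex.Caps j → Fin 2) :
    coord p j vQ (f x) ε = ∑ ε', coord p j vQ x ε' * coord p j vQ (f (tb p j vQ ε')) ε := by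
  have h : (coordL p j vQ ε ∘ₗ f) (∑ ε', coord p j vQ x ε' • tb p j vQ ε') =
      ∑ ε', coord p j vQ x ε' • (coordL p j vQ ε ∘ₗ f) (tb p j vQ ε') := by
    rw [map_sum]
    exact Finset.sum_congr rfl fun ε' _ => map_smul _ _ _
  rw [sum_coord_smul_tb] at h
  simpa only [LinearMap.comp_apply, coordL_apply, smul_eq_mul] using h

variable {p}

/-- A linear map whose matrix entries in the tensor basis are `p`-integral maps integral vectors to integral vectors. [folklore] -/
theorem integral_map [Fact p.Prime] {j : toyIndex.Label} {vQ : toyIndex.VQ}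
    (f : (ramShells p).Packet j vQ →ₗ[ℚ] (ramShells p).Packet j vQ) (hf : ∀ ε', Integral p j vQ (f (tb p j vQ ε')))
    {x : (ramShells p).Packet j vQ} (hx : Integral p j vQ x) : Integral p j vQ (f x) := fun ε => by
  rw [coord_map_eq_sum]
  exact ple_sum _ _ fun ε' _ => (hx ε').mul' (hf ε' ε)

/-- Basis vectors are integral. [folklore] -/
theorem integral_tb [Fact p.Prime] (j : toyIndex.Label) (vQ : toyIndex.VQ) (ε : toyIndex.Caps j → Fin 2) :
    Integral p j vQ (tb p j vQ ε) := fun ε' => by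
  rw [coord_tb]
  split_ifs
  · exact isPInt_one
  · exact ple_zero 0

/-- **A factorwise lattice automorphism (an (Ind2)-generator, or the strip part of an (Ind1)-generator) preserves integrality**:
its matrix in the tensor basis is the Kronecker product of `GL_2(ℤ_(p))`-matrices. [folklore] -/
theorem integral_factorwise [Fact p.Prime] {j : toyIndex.Label} {vQ : toyIndex.VQ}
    (g : toyIndex.Caps j → ∀ v : toyIndex.Fibre vQ, (Fin 2 → ℚ) ≃ₗ[ℚ] (Fin 2 → ℚ)) (hg : ∀ i v, g i v ∈ latticeAuts p)
    {x : (ramShells p).Packet j vQ} (hx : Integral p j vQ x) :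
    Integral p j vQ ((ramShells p).factorwise j vQ (fun i => (ramShells p).summandwise vQ (g i)) x) := by
  refine integral_map ((ramShells p).factorwise j vQ fun i => (ramShells p).summandwise vQ (g i)).toLinearMap
    (fun ε' ε => ?_) hx
  rw [LinearEquiv.coe_coe, tb_apply]
  unfold LogShells.factorwise
  erw [PiTensorProduct.congr_tprod, coord_tprod]
  refine isPInt_prod _ _ fun i _ => ?_
  have h : ((ramShells p).summandwise vQ (g i) (b1 p vQ (ε' i))) (fib vQ) = g i (fib vQ) (Pi.single (ε' i) 1) := by
    show g i (fib vQ) (b1 p vQ (ε' i) (fib vQ)) = _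
    rw [b1_apply]
  rw [h]
  exact isPInt_ent (hg i (fib vQ)) (ε i) (ε' i)

/-- **A permutation of the tensor factors preserves integrality** (it permutes the tensor basis). [folklore] -/
theorem integral_permute [Fact p.Prime] {j : toyIndex.Label} {vQ : toyIndex.VQ} (σ : Equiv.Perm (toyIndex.Caps j))
    {x : (ramShells p).Packet j vQ} (hx : Integral p j vQ x) : Integral p j vQ ((ramShells p).permute j vQ σ x) := by
  refine integral_map ((ramShells p).permute j vQ σ).toLinearMap (fun ε' => ?_) hx
  rw [LinearEquiv.coe_coe, tb_apply]
  unfold LogShells.permute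
  erw [PiTensorProduct.reindex_tprod]
  rw [← tb_apply]
  exact integral_tb j vQ _

/-- A packet-automorphism family ACTS INTEGRALLY if it and its inverse map integral vectors to integral vectors on every packet
(the property propagated through the group generated by (Ind1), (Ind2); a local bookkeeping predicate, not a fact). [folklore] -/
structure ActsIntegrally (Φ : (ramShells p).PacketAut) : Prop where
  /-- `Φ` preserves integrality -/
  fwd : ∀ (j : toyIndex.Label) (vQ : toyIndex.VQ) (x : (ramShells p).Packet j vQ), Integral p j vQ x → Integral p j vQ (Φ j vQ x)
  /-- `Φ⁻¹` preserves integrality -/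
  bwd : ∀ (j : toyIndex.Label) (vQ : toyIndex.VQ) (x : (ramShells p).Packet j vQ), Integral p j vQ x → Integral p j vQ (Φ⁻¹ j vQ x)

/-- The identity family acts integrally. [folklore] -/
theorem actsIntegrally_one : ActsIntegrally (p := p) 1 :=
  ⟨fun _ _ _ hx => hx, fun _ _ _ hx => by rw [inv_one]; exact hx⟩

/-- Acting integrally is closed under products. [folklore] -/
theorem ActsIntegrally.mul {Φ Ψ : (ramShells p).PacketAut} (hΦ : ActsIntegrally Φ) (hΨ : ActsIntegrally Ψ) :
    ActsIntegrally (Φ * Ψ) :=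
  ⟨fun j vQ x hx => hΦ.fwd j vQ _ (hΨ.fwd j vQ x hx), fun j vQ x hx => by
    rw [mul_inv_rev]; exact hΨ.bwd j vQ _ (hΦ.bwd j vQ x hx)⟩

/-- Acting integrally is closed under inverses. [folklore] -/
theorem ActsIntegrally.inv' {Φ : (ramShells p).PacketAut} (hΦ : ActsIntegrally Φ) : ActsIntegrally Φ⁻¹ :=
  ⟨hΦ.bwd, fun j vQ x hx => by rw [inv_inv]; exact hΦ.fwd j vQ x hx⟩

section WithPrime

variable [hp : Fact p.Prime]

omit hp in
/-- The pointwise inverse of a family of lattice automorphisms is a family of lattice automorphisms. [folklore] -/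
theorem inv_mem_latticeAuts {j : toyIndex.Label} {vQ : toyIndex.VQ}
    {g : toyIndex.Caps j → ∀ v : toyIndex.Fibre vQ, (Fin 2 → ℚ) ≃ₗ[ℚ] (Fin 2 → ℚ)} (hg : ∀ i v, g i v ∈ latticeAuts p)
    (i : toyIndex.Caps j) (v : toyIndex.Fibre vQ) : (g⁻¹) i v ∈ latticeAuts p :=
  symm_mem_latticeAuts (hg i v)

omit hp in
/-- The inverse of a factorwise automorphism is the factorwise automorphism of the inverses. [folklore] -/
theorem factorwise_summandwise_inv (j : toyIndex.Label) (vQ : toyIndex.VQ)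
    (g : toyIndex.Caps j → ∀ v : toyIndex.Fibre vQ, (Fin 2 → ℚ) ≃ₗ[ℚ] (Fin 2 → ℚ)) :
    ((ramShells p).factorwise j vQ fun i => (ramShells p).summandwise vQ (g i))⁻¹ =
      (ramShells p).factorwise j vQ fun i => (ramShells p).summandwise vQ ((g⁻¹) i) := by
  rw [← LogShells.factorwise_inv]
  rfl

/-- Every (Ind2)-family of the ramified shells acts integrally. [folklore] -/
theorem actsIntegrally_of_mem_Ind2Family {Φ : (ramShells p).PacketAut} (h : Φ ∈ (ramShells p).Ind2Family) :
    ActsIntegrally Φ := by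
  refine ⟨fun j vQ x hx => ?_, fun j vQ x hx => ?_⟩
  · obtain ⟨g, hg, hΦ⟩ := h j vQ
    rw [hΦ]
    exact integral_factorwise g hg hx
  · obtain ⟨g, hg, hΦ⟩ := h j vQ
    rw [Pi.inv_apply, Pi.inv_apply, hΦ, factorwise_summandwise_inv]
    exact integral_factorwise _ (inv_mem_latticeAuts hg) hx

/-- Every (Ind1)-family of the ramified shells acts integrally. [folklore] -/
theorem actsIntegrally_of_mem_Ind1Family {Φ : (ramShells p).PacketAut} (h : Φ ∈ (ramShells p).Ind1Family) :
    ActsIntegrally Φ := by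
  refine ⟨fun j vQ x hx => ?_, fun j vQ x hx => ?_⟩
  · obtain ⟨σ, hh, hmem, hΦ⟩ := h j
    have hΦ' : Φ j vQ = ((ramShells p).permute j vQ σ).trans
        ((ramShells p).factorwise j vQ fun i => (ramShells p).summandwise vQ fun v => hh i v.1) := hΦ vQ
    rw [hΦ', LinearEquiv.trans_apply]
    exact integral_factorwise (fun i v => hh i v.1) (fun i v => hmem i v.1) (integral_permute σ hx)
  · obtain ⟨σ, hh, hmem, hΦ⟩ := h j
    have hΦ' : Φ j vQ = ((ramShells p).factorwise j vQ fun i => (ramShells p).summandwise vQ fun v => hh i v.1) *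
        (ramShells p).permute j vQ σ := by
      rw [LinearEquiv.mul_eq_trans]; exact hΦ vQ
    rw [Pi.inv_apply, Pi.inv_apply, hΦ', mul_inv_rev, factorwise_summandwise_inv, ← LogShells.permute_inv,
      LinearEquiv.mul_apply]
    exact integral_permute σ⁻¹ (integral_factorwise _ (inv_mem_latticeAuts fun i v => hmem i v.1) hx)

/-- **Every element of the group generated by (Ind1), (Ind2) acts integrally**: it maps the packet log-shell lattice `𝕀` into
itself on every packet (and so does its inverse). [folklore] -/
theorem actsIntegrally_of_mem_closure {Φ : (ramShells p).PacketAut}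
    (h : Φ ∈ Subgroup.closure ((ramShells p).Ind1Family ∪ (ramShells p).Ind2Family)) : ActsIntegrally Φ := by
  induction h using Subgroup.closure_induction with
  | mem Ψ hΨ =>
    rcases hΨ with h1 | h2
    · exact actsIntegrally_of_mem_Ind1Family h1
    · exact actsIntegrally_of_mem_Ind2Family h2
  | one => exact actsIntegrally_one
  | mul Ψ Ψ' _ _ hΨ hΨ' => exact hΨ.mul hΨ'
  | inv Ψ _ hΨ => exact hΨ.inv'

end WithPrime

/-! ## 2. The swap `1 ↔ π` and the swap family -/

variable (p)

/-- **The SWAP `1 ↔ π`** of `ℚ² = ℚ·1 ⊕ ℚ·π`: a lattice automorphism of `I` that is NOT `𝒪_K`-semi-linear (it maps the prime `π` to the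
unit `1`). [folklore] -/
def swap2 : (Fin 2 → ℚ) ≃ₗ[ℚ] (Fin 2 → ℚ) := LinearEquiv.funCongrLeft ℚ ℚ (Equiv.swap (0 : Fin 2) 1)

/-- `swap2 x a = x (swap a)`. [folklore] -/
theorem swap2_apply (x : Fin 2 → ℚ) (a : Fin 2) : swap2 x a = x (Equiv.swap (0 : Fin 2) 1 a) := rfl

/-- The swap is a lattice automorphism. [folklore] -/
theorem swap2_mem_latticeAuts : swap2 ∈ latticeAuts p := fun x =>
  ⟨fun hx a => hx _, fun hx a => by
    have h := hx (Equiv.swap (0 : Fin 2) 1 a)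
    rwa [swap2_apply, Equiv.swap_apply_self] at h⟩

/-- The swap exchanges the basis vectors: `swap2 e_a = e_{swap a}`. [folklore] -/
theorem swap2_single (a : Fin 2) : swap2 (Pi.single a (1 : ℚ)) = Pi.single (Equiv.swap (0 : Fin 2) 1 a) 1 := by
  ext b
  rw [swap2_apply, Pi.single_apply, Pi.single_apply]
  congr 1
  exact propext ⟨fun h => by rw [← h, Equiv.swap_apply_self], fun h => by rw [h, Equiv.swap_apply_self]⟩

/-- **The SWAP FAMILY**: swap `1 ↔ π` on every summand of every tensor factor of every packet. [claim: Mochizuki2012, status: disputed] -/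
def swapFam : (ramShells p).PacketAut := fun j vQ =>
  (ramShells p).factorwise j vQ fun _ => (ramShells p).summandwise vQ fun _ => swap2

/-- The swap family is an (Ind2)-family of the ramified shells … [folklore] -/
theorem swapFam_mem_Ind2Family : swapFam p ∈ (ramShells p).Ind2Family := fun _ _ =>
  ⟨fun _ _ => swap2, fun _ _ => swap2_mem_latticeAuts p, rfl⟩

/-- … hence an element of `⟨(Ind1) ∪ (Ind2)⟩`. [folklore] -/
theorem swapFam_mem_closure :
    swapFam p ∈ Subgroup.closure ((ramShells p).Ind1Family ∪ (ramShells p).Ind2Family) :=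
  Subgroup.subset_closure (Or.inr (swapFam_mem_Ind2Family p))

/-- **The swap family moves the tensor basis**: `swapFam (e_ε) = e_{swap ∘ ε}`; in particular it carries `e_{π…π}` (the
`p`-adically SMALLEST basis monomial, `wt = j+1`) to `e_{1…1}` (the largest, `wt = 0`). [folklore] -/
theorem swapFam_tb (j : toyIndex.Label) (vQ : toyIndex.VQ) (ε : toyIndex.Caps j → Fin 2) :
    swapFam p j vQ (tb p j vQ ε) = tb p j vQ (fun i => Equiv.swap (0 : Fin 2) 1 (ε i)) := by
  rw [tb_apply, tb_apply]
  unfold swapFam LogShells.factorwise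
  erw [PiTensorProduct.congr_tprod]
  congr 1
  funext i
  funext v
  show swap2 (b1 p vQ (ε i) v) = b1 p vQ (Equiv.swap (0 : Fin 2) 1 (ε i)) v
  rw [b1_apply, b1_apply, swap2_single]

end Summit.ABC.IUTFork.Cor312Vol.RamifiedWitness

end
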